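import Summits.FinalStateConjecture.FinalStateConjecture.Theses.DerivativeThrift

/-!
# `ThriftyKerrStability` (stmt-FinalStateConjecture-17610, route DerivativeThrift, rank 2):
# by-name reductions of line `registered` (birth skeleton) — the uniform crux dominates the cut

Helper file of the line lead (crux `DerivativeThrift.ThriftyKerrStability`; skeleton
`Cruxes/ThriftyKerrStability/Lines/birth.lean`, stubs `stub_thriftOrbital` (K, orbital stability at
thrift regularity) and `stub_orbitalToAsymptotic` (C, asymptotic from orbital), composition
`ThriftyKerrStability_of : K → C → crux`). Everything here is sorry-free, definition-free pure logic;
the one hypothesis is written out verbatim (no `def`): the **uniform crux** `U` = the crux made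
(i) locally uniform in the centre — the `δ` chosen from `(M₀, a₀, ℓ, η)` serves every sub-extremal
`(M₂, a₂)` with `|M₂ − M₀| + |a₂ − a₀| ≤ δ` — and (ii) region-relative — `J⁺(S)` for an arbitrary
region `S` in place of `J⁺(range Φ)`, and no `range Φ ⊆ J⁺(ιX)` side condition. This is the shape in
which any perturbative proof of the crux would come out (basin constants continuous in the centre,
the region entering only through `J⁺`-bookkeeping); it is an OPEN PROBLEM exactly like the crux
(no tree fact: the nearest vendored statement, `hintz_kerr_stability_subextremal_cauchy`, is posed on
an asymptotically flat Kerr slice at one large Sobolev order — other hypersurface, norm and order).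

* `thriftyKerrStability_of_uniform` — `U → ThriftyKerrStability` (`ε := δ`, `S := range Φ` by
  reflexivity `S ⊆ J⁺(S)`, centre `(M₀, a₀)` itself): the crux is the pointwise-in-the-centre,
  `S = range Φ` instance of `U`.
* `stub_orbitalToAsymptotic_of_uniform` — `U → C` with C's registered signature VERBATIM, and the
  proof DISCARDS the orbital near-zone data of C's certificate (the late chart `Ψ`, the radii `R`,
  the `δ`-deviation bound, the orientation clause): only ONE `δ`-thrifty `(M₂, a₂)`-layer
  `Φ₂ ⊆ J⁺(S)` from the certificate's last clause (at an arbitrary event; the carrier is connected,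
  hence nonempty) is handed to `U` at the same region `S`.

Reading for the planner (recorded with the item as CUT-AUDIT.md): along the plumbing route the
Martel–Merle cut `K ∘ C` is dominated by the single statement `U` — `U` closes the crux without K,
and discharges C without its orbital hypotheses — so the line lowers the crux only if C is proved by
a route that does NOT re-run one-time-small-data stability from a late layer (compactness of the
orbit + a Liouville/rigidity theorem for eternal near-Kerr vacuum exteriors, cf. the summit's
`LaSalleTransfer`, `OmegaLimitMultiKerr`, `EternalStationaryExteriorIsKerr` cruxes), and if K
(time-uniform `k = 2` boundedness plus persistence of thrift on late layers) is proved without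
proving decay. Neither is known in print at any regularity. Nothing here is analysis.
-/

-- the doubled `FinalStateConjecture.FinalStateConjecture` path component trips dupNamespace
set_option linter.dupNamespace false

noncomputable section

open scoped Manifold ContDiff Topology ENNReal
open Filter Set Function

namespace Summit.FinalStateConjecture.FinalStateConjecture.Theorems.DerivativeThriftThriftyKerrStability

open Literature.Geometry.Lorentzian
open Summit.FinalStateConjecture.FinalStateConjecture.Theses.DerivativeThrift (ThriftyKerrStability)

/-- **The crux from the uniform crux.** If thrifty Kerr stability at `k = 2` holds locally
uniformly in the centre and relative to an arbitrary region `S` (hypothesis `hU`, written out; an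
open problem, no tree fact), then `ThriftyKerrStability` holds: take `ε := δ`, the centre
`(M₂, a₂) := (M₀, a₀)` and `S := range Φ`, using reflexivity `range Φ ⊆ J⁺(range Φ)`
(`LorentzianMetric.subset_causalFuture`); the hypothesis `range Φ ⊆ J⁺(ιX)` of the crux is not
needed. Pure logic. [folklore] -/
theorem thriftyKerrStability_of_uniform
    (hU : ∀ (M₀ a₀ : ℝ), Kerr.IsSubextremal M₀ a₀ → ∀ ℓ : ℝ, 4 * M₀ ≤ ℓ → ∀ η : ℝ, 0 < η → ∃ δ : ℝ, 0 < δ ∧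
      ∀ (X : Type) [TopologicalSpace X] [ChartedSpace E3 X] [IsManifold (𝓡 3) ∞ X] [T2Space X]
      [SecondCountableTopology X] [ConnectedSpace X] (D : InitialDataSet (𝓡 3) X),
      D ∈ admissibleVacuumData X → ∀ 𝒟 : VacuumCauchyDevelopment D, 𝒟.IsMaximal →
      ∀ (S : Set 𝒟.carrier) (M₂ a₂ τ₂ : ℝ)
      (Φ₂ : RecedingKerr.layer (fun _ : Fin 1 ↦ M₂) (fun _ ↦ a₂) (fun _ ↦ 1) (fun _ ↦ 0) τ₂ ℓ →
      𝒟.carrier),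
      Kerr.IsSubextremal M₂ a₂ → |M₂ - M₀| + |a₂ - a₀| ≤ δ →
      ContMDiff 𝓘(ℝ, E4) (𝓡 4) ∞ Φ₂ → Topology.IsOpenEmbedding Φ₂ →
      Set.range Φ₂ ⊆ 𝒟.metric.causalFuture 𝒟.timeOrientation S →
      (∀ s₀ ∈ Set.Ioo 0 ℓ, 𝒟.metric.IsAchronal 𝒟.timeOrientation
      (Φ₂ '' {x | RecedingKerr.layerTime τ₂ ℓ x.1 = s₀})) →
      𝒟.toSpacetime.recedingKerrInitialLayerNorm (fun _ : Fin 1 ↦ M₂) (fun _ ↦ a₂) (fun _ ↦ 1)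
      (fun _ ↦ 0) τ₂ ℓ 2 (1 / 2) (1 / 2) Φ₂ ≤ ENNReal.ofReal δ →
      ∃ (M' a' τ'' : ℝ) (Ψ' : (Kerr.background M' a').domain → 𝒟.carrier) (R' : ℝ → ℝ),
      Kerr.IsSubextremal M' a' ∧ |M' - M₀| + |a' - a₀| ≤ η ∧
      𝒟.toSpacetime.IsLateChart (Kerr.background M' a')
      (𝒟.metric.causalFuture 𝒟.timeOrientation S) τ'' Ψ' ∧
      Filter.Tendsto R' Filter.atTop Filter.atTop ∧
      Filter.Tendsto
      (fun σ ↦ 𝒟.toSpacetime.truncDeviationCk (Kerr.background M' a') Ψ' 2 (R' σ) σ)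
      Filter.atTop (nhds 0) ∧
      ∀ ρ : ℝ, ∀ᶠ σ in Filter.atTop, ∀ x ∈ (Kerr.background M' a').truncTimeSlab ρ σ,
      𝒟.timeOrientation.IsFutureDirected
      (mfderiv 𝓘(ℝ, E4) (𝓡 4) Ψ' x (Kerr.timeVector M' a' (x : E4)))) :
    ThriftyKerrStability := by
  intro M₀ a₀ hsub ℓ hℓ η hη
  obtain ⟨δ, hδ, h⟩ := hU M₀ a₀ hsub ℓ hℓ η hη
  refine ⟨δ, hδ, ?_⟩
  intro X _ _ _ _ _ _ D hD 𝒟 hmax τ Φ hΦ hemb _hJ hachr hN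
  have hpar : |M₀ - M₀| + |a₀ - a₀| ≤ δ := by simp [hδ.le]
  exact h X D hD 𝒟 hmax (Set.range Φ) M₀ a₀ τ Φ hsub hpar hΦ hemb
    (LorentzianMetric.subset_causalFuture _ _ _) hachr hN

/-- **Stub C (`stub_orbitalToAsymptotic`, registered signature verbatim) from the uniform crux, the
orbital data discarded.** Given `hU`, for the tolerance `η` take the `δ` of `hU`; from an orbital
certificate at level `δ` relative to `S` keep only the sub-extremality and `δ`-closeness of the
modulated centre `(M₂, a₂)` and ONE `δ`-thrifty `(M₂, a₂)`-layer `Φ₂ ⊆ J⁺(S)` of scale `ℓ` (its last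
clause, instantiated at any event — `𝒟.carrier` is a `ConnectedSpace`, hence nonempty), and hand it
to `hU` at the region `S`; the late chart `Ψ`, the radii `R`, the deviation bound and the orientation
clause are never used. Records that C is weaker than the uniform crux (sanity of the cut) and that
the cut is dominated by it (CUT-AUDIT.md). Pure logic. [folklore] -/
theorem stub_orbitalToAsymptotic_of_uniform
    (hU : ∀ (M₀ a₀ : ℝ), Kerr.IsSubextremal M₀ a₀ → ∀ ℓ : ℝ, 4 * M₀ ≤ ℓ → ∀ η : ℝ, 0 < η → ∃ δ : ℝ, 0 < δ ∧
      ∀ (X : Type) [TopologicalSpace X] [ChartedSpace E3 X] [IsManifold (𝓡 3) ∞ X] [T2Space X]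
      [SecondCountableTopology X] [ConnectedSpace X] (D : InitialDataSet (𝓡 3) X),
      D ∈ admissibleVacuumData X → ∀ 𝒟 : VacuumCauchyDevelopment D, 𝒟.IsMaximal →
      ∀ (S : Set 𝒟.carrier) (M₂ a₂ τ₂ : ℝ)
      (Φ₂ : RecedingKerr.layer (fun _ : Fin 1 ↦ M₂) (fun _ ↦ a₂) (fun _ ↦ 1) (fun _ ↦ 0) τ₂ ℓ →
      𝒟.carrier),
      Kerr.IsSubextremal M₂ a₂ → |M₂ - M₀| + |a₂ - a₀| ≤ δ →
      ContMDiff 𝓘(ℝ, E4) (𝓡 4) ∞ Φ₂ → Topology.IsOpenEmbedding Φ₂ →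
      Set.range Φ₂ ⊆ 𝒟.metric.causalFuture 𝒟.timeOrientation S →
      (∀ s₀ ∈ Set.Ioo 0 ℓ, 𝒟.metric.IsAchronal 𝒟.timeOrientation
      (Φ₂ '' {x | RecedingKerr.layerTime τ₂ ℓ x.1 = s₀})) →
      𝒟.toSpacetime.recedingKerrInitialLayerNorm (fun _ : Fin 1 ↦ M₂) (fun _ ↦ a₂) (fun _ ↦ 1)
      (fun _ ↦ 0) τ₂ ℓ 2 (1 / 2) (1 / 2) Φ₂ ≤ ENNReal.ofReal δ →
      ∃ (M' a' τ'' : ℝ) (Ψ' : (Kerr.background M' a').domain → 𝒟.carrier) (R' : ℝ → ℝ),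
      Kerr.IsSubextremal M' a' ∧ |M' - M₀| + |a' - a₀| ≤ η ∧
      𝒟.toSpacetime.IsLateChart (Kerr.background M' a')
      (𝒟.metric.causalFuture 𝒟.timeOrientation S) τ'' Ψ' ∧
      Filter.Tendsto R' Filter.atTop Filter.atTop ∧
      Filter.Tendsto
      (fun σ ↦ 𝒟.toSpacetime.truncDeviationCk (Kerr.background M' a') Ψ' 2 (R' σ) σ)
      Filter.atTop (nhds 0) ∧
      ∀ ρ : ℝ, ∀ᶠ σ in Filter.atTop, ∀ x ∈ (Kerr.background M' a').truncTimeSlab ρ σ,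
      𝒟.timeOrientation.IsFutureDirected
      (mfderiv 𝓘(ℝ, E4) (𝓡 4) Ψ' x (Kerr.timeVector M' a' (x : E4)))) :
    open Literature.Geometry.Lorentzian in open scoped Manifold ContDiff in ∀ (M₀ a₀ : ℝ), Kerr.IsSubextremal M₀ a₀ → ∀ ℓ : ℝ, 4 * M₀ ≤ ℓ → ∀ η : ℝ, 0 < η → ∃ δ : ℝ, 0 < δ ∧ ∀ (X : Type) [TopologicalSpace X] [ChartedSpace E3 X] [IsManifold (𝓡 3) ∞ X] [T2Space X] [SecondCountableTopology X] [ConnectedSpace X] (D : InitialDataSet (𝓡 3) X), D ∈ admissibleVacuumData X → ∀ 𝒟 : VacuumCauchyDevelopment D, 𝒟.IsMaximal → ∀ (S : Set 𝒟.carrier) (M₂ a₂ τ' : ℝ) (Ψ : (Kerr.background M₂ a₂).domain → 𝒟.carrier) (R : ℝ → ℝ), (Kerr.IsSubextremal M₂ a₂ ∧ |M₂ - M₀| + |a₂ - a₀| ≤ δ ∧ 𝒟.toSpacetime.IsLateChart (Kerr.background M₂ a₂) (𝒟.metric.causalFuture 𝒟.timeOrientation S) τ' Ψ ∧ Filter.Tendsto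 R Filter.atTop Filter.atTop ∧ (∀ σ : ℝ, τ' ≤ σ → 𝒟.toSpacetime.truncDeviationCk (Kerr.background M₂ a₂) Ψ 2 (R σ) σ ≤ ENNReal.ofReal δ) ∧ (∀ ρ : ℝ, ∀ᶠ σ in Filter.atTop, ∀ x ∈ (Kerr.background M₂ a₂).truncTimeSlab ρ σ, 𝒟.timeOrientation.IsFutureDirected (mfderiv 𝓘(ℝ, E4) (𝓡 4) Ψ x (Kerr.timeVector M₂ a₂ (x : E4)))) ∧ ∀ q : 𝒟.carrier, ∃ (τ₂ : ℝ) (Φ₂ : RecedingKerr.layer (fun _ : Fin 1 ↦ M₂) (fun _ ↦ a₂) (fun _ ↦ 1) (fun _ ↦ 0) τ₂ ℓ → 𝒟.carrier), ContMDiff 𝓘(ℝ, E4) (𝓡 4) ∞ Φ₂ ∧ Topology.IsOpenEmbedding Φ₂ ∧ Set.range Φ₂ ⊆ 𝒟.metric.causalFuture 𝒟.timeOrientation S ∧ (∀ s₀ ∈ Set.Ioo 0 ℓ, 𝒟.metric.IsAchronal 𝒟.timeOrientation (Φ₂ '' {x | RecedingKerr.layerTime τ₂ ℓ x.1 = s₀}))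 ∧ 𝒟.toSpacetime.recedingKerrInitialLayerNorm (fun _ : Fin 1 ↦ M₂) (fun _ ↦ a₂) (fun _ ↦ 1) (fun _ ↦ 0) τ₂ ℓ 2 (1 / 2) (1 / 2) Φ₂ ≤ ENNReal.ofReal δ ∧ q ∉ 𝒟.metric.causalFuture 𝒟.timeOrientation (Set.range Φ₂)) → ∃ (M' a' τ'' : ℝ) (Ψ' : (Kerr.background M' a').domain → 𝒟.carrier) (R' : ℝ → ℝ), Kerr.IsSubextremal M' a' ∧ |M' - M₀| + |a' - a₀| ≤ η ∧ 𝒟.toSpacetime.IsLateChart (Kerr.background M' a') (𝒟.metric.causalFuture 𝒟.timeOrientation S) τ'' Ψ' ∧ Filter.Tendsto R' Filter.atTop Filter.atTop ∧ Filter.Tendsto (fun σ ↦ 𝒟.toSpacetime.truncDeviationCk (Kerr.background M' a') Ψ' 2 (R' σ) σ) Filter.atTop (nhds 0) ∧ ∀ ρ : ℝ, ∀ᶠ σ in Filter.atTop, ∀ x ∈ (Kerr.background M' a').truncTimeSlab ρ σ, 𝒟.timeOrientation.IsFutureDirected (mfderiv 𝓘(ℝ, E4) (𝓡 4) Ψ'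 x (Kerr.timeVector M' a' (x : E4))) := by
  intro M₀ a₀ hsub ℓ hℓ η hη
  obtain ⟨δ, hδ, h⟩ := hU M₀ a₀ hsub ℓ hℓ η hη
  refine ⟨δ, hδ, ?_⟩
  intro X _ _ _ _ _ _ D hD 𝒟 hmax S M₂ a₂ τ' Ψ R hcert
  obtain ⟨hsub₂, hpar, -, -, -, -, hlayers⟩ := hcert
  obtain ⟨q⟩ := (inferInstance : Nonempty 𝒟.carrier)
  obtain ⟨τ₂, Φ₂, hΦ, hemb, hJ, hachr, hN, -⟩ := hlayers q
  exact h X D hD 𝒟 hmax S M₂ a₂ τ₂ Φ₂ hsub₂ hpar hΦ hemb hJ hachr hN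

end Summit.FinalStateConjecture.FinalStateConjecture.Theorems.DerivativeThriftThriftyKerrStability

end
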